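import Summits.QuantumFields.QCD.Theorems.WilsonMobilityGapMobilityGapLightWitness
import Summits.QuantumFields.QCD.Theorems.PauliWegnerSeaOneScaleTrajectoryOfUpper
import Summits.QuantumFields.QCD.Theorems.PauliWegnerSeaChiralOneScaleTrajectorySignCoherence
import Summits.QuantumFields.QCD.Theorems.PauliWegnerSeaChiralOneScaleTrajectoryTransferAE

/-!
# The positive-mass branch of `ChiralOneScaleTrajectory` (stmt-QuantumFields-17512, line `Sketch`, lead c3-0):
# along positive lattice-light bare masses the crux IS "clause (iii) with no rate floor" — a map, not a line

Support file (prover, item-scoped, `--supports stmt-QuantumFields-17512`). Pure composition of landed results; no new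
definitions.

By `Negative/CriticalMassLimsup.lean` clause (iii) forces every realised bare mass of a witness below every positive
constant eventually, so a witness of the crux lives either on the POSITIVE LIGHT BRANCH (`0 < m_f(k) = O(a_k)`-ish,
`κ → 1/8⁻`) or in the supercritical window (`m_f(k) ≤ 0` frequently).  This file certifies what the positive branch
costs:

* `signCoh_one_of_eventually_pos` — at positive degenerate bare masses the signed second-moment quotient of the pin
  chain equals the phase-quenched one (Seiler positivity `det_diracMatrix_eq_norm_of_pos`), so the card's kernel Sign₃
  holds with `θ = 1` for EVERY `N_f` (not only `N_f = 2`).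
* `isChiralAtZero_of_noCollapse_pos` — hence, for any `N_f ≥ 2`, NoCollapse lower pins at positive degenerate tuples
  plus superlogarithmic volume give `reg.IsChiralAtZero` (landed chain `signedPin_of_lowerPins_signCoh` →
  `chiralityTransfer_ae`).
* `chiralOneScaleTrajectory_of_posLowerNoCollapse` — **the crux follows from ONE estimate family about ONE explicit
  class of regularisations**: for `N_f ∈ {2,3}` some AF mass-scaling `reg` with `c a_k ≤ m_crit(k) ≤ 1/2` eventually and
  `a_k L_k/(1+|log a_k|) → ∞` satisfies clause (iii) LOWER at every positive tuple, with no rate floor at the degenerate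
  tuples (`inf_m C₁(m,…,m)/s(m) = 0`, NoCollapse).  Everything else in the crux — (i), the one-scale shell (via the
  deterministic (ii) of `…LightWitness` and `oneScale_of_upper`), (iv), the sign kernel and the Wick–γ₅–Jensen transfer —
  is free on this branch.

PHYSICS CAVEAT (why this is a map of the content and closes line `Sketch`, not a proof strategy).  The hypothesis is
expected to be FALSE: the additive mass renormalisation of Wilson fermions is negative at weak coupling
(`m_c(β) ≈ −0.87/β`), so a quark of bare mass `≍ a_k > 0 > m_c(β_k)` is lattice-massive at rate `≍ 1/β_k ≫ a_k` and
violates the `O(a_k)` floor of (iii) — but neither that violation (rigorous mass generation) nor the honest (iii) at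
`m_crit(k) ≈ m_c(β_k) < 0` is within reach of the tree.  With `Negative/CriticalMassLimsup.lean` and the disproof's
§2 this exhausts the cheap branches: every line on this crux must construct `m_crit(k)` in the supercritical window and
prove (iii) there.
-/

noncomputable section

namespace Summit.QuantumFields.QCD.Cruxes.ChiralOneScaleTrajectory.GoldstoneWitness

open scoped BigOperators Topology
open MeasureTheory Filter Set
open Literature.MathematicalPhysics.QuantumFieldTheory Literature.MathematicalPhysics.QuantumLattice
  Literature.Probability.LatticeModels
open Summit.QuantumFields.QCD.Theorems.MobilityGapNegative
open Summit.QuantumFields.QCD.Theorems.MobilityGapPositiveMass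
open Summit.QuantumFields.QCD.Theorems.OneScaleTrajectoryContent
open Summit.QuantumFields.QCD.Theses.PauliWegnerSea (ChiralOneScaleTrajectory)

variable {Nf : ℕ}

/-- **Sign kernel with `θ = 1` at positive degenerate bare masses (every `N_f`).** If for every `m > 0` the
degenerate bare mass `m_crit(k) + a_k m/Z_m(k)` is positive eventually, then the signed second-moment quotient at
`S = n = L_k` has norm at least the phase-quenched one (in fact they are equal): `det D = |det D|` pointwise by Seiler
positivity. [folklore] -/
theorem signCoh_one_of_eventually_pos (reg : QCDRegularisation Nf) (f : Fin Nf)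
    (hpos : ∀ m : ℝ, 0 < m → ∀ᶠ k in atTop, 0 < reg.mcrit k + reg.a k * m / reg.Zm k) :
    (∃ θ : ℝ, 0 < θ ∧ ∀ m : ℝ, 0 < m → ∀ᶠ k in atTop, θ * ((∫ U : GaugeConfig 4 (2 * reg.L k + 1) (Matrix.specialUnitaryGroup (Fin 3) ℂ), ‖(diracMatrix U fun _ : Fin Nf => reg.mcrit k + reg.a k * m / reg.Zm k).det‖ * (∑ a : Fin 3, ∑ i : Fin 4, ∑ b : Fin 3, ∑ j : Fin 4, ‖(diracMatrix U fun _ : Fin Nf => reg.mcrit k + reg.a k * m / reg.Zm k)⁻¹ (quarkEquiv (f, (Torus.proj (2 * reg.L k + 1) 0, a, i))) (quarkEquiv (f, (Torus.proj (2 * reg.L k + 1) (Pi.single 0 (reg.L k : ℤ)), b, j)))‖ ^ (2 : ℕ)) ∂(wilsonMeasure (fundamentalRep (Fin 3)) (reg.β k))) / (∫ U : GaugeConfig 4 (2 * reg.L k + 1) (Matrix.specialUnitaryGroup (Fin 3) ℂ), ‖(diracMatrix U fun _ : Fin Nf => reg.mcrit k + reg.a k * m / reg.Zm k).det‖ ∂(wilsonMeasure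 (fundamentalRep (Fin 3)) (reg.β k)))) ≤ ‖(∫ U : GaugeConfig 4 (2 * reg.L k + 1) (Matrix.specialUnitaryGroup (Fin 3) ℂ), (diracMatrix U fun _ : Fin Nf => reg.mcrit k + reg.a k * m / reg.Zm k).det * ((∑ a : Fin 3, ∑ i : Fin 4, ∑ b : Fin 3, ∑ j : Fin 4, ‖(diracMatrix U fun _ : Fin Nf => reg.mcrit k + reg.a k * m / reg.Zm k)⁻¹ (quarkEquiv (f, (Torus.proj (2 * reg.L k + 1) 0, a, i))) (quarkEquiv (f, (Torus.proj (2 * reg.L k + 1) (Pi.single 0 (reg.L k : ℤ)), b, j)))‖ ^ (2 : ℕ) : ℝ) : ℂ) ∂(wilsonMeasure (fundamentalRep (Fin 3)) (reg.β k))) / (∫ U : GaugeConfig 4 (2 * reg.L k + 1) (Matrix.specialUnitaryGroup (Fin 3) ℂ), (diracMatrix U fun _ : Fin Nf => reg.mcrit k + reg.a k * m / reg.Zm k).det ∂(wilsonMeasure (fundamentalRep (Fin 3)) (reg.β k)))‖) := by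
  refine ⟨1, one_pos, fun m hm => (hpos m hm).mono fun k hk => ?_⟩
  set mq : Fin Nf → ℝ := fun _ => reg.mcrit k + reg.a k * m / reg.Zm k with hmq
  set μ := wilsonMeasure (d := 4) (L := 2 * reg.L k + 1) (fundamentalRep (Fin 3)) (reg.β k) with hμ
  set X : GaugeConfig 4 (2 * reg.L k + 1) (Matrix.specialUnitaryGroup (Fin 3) ℂ) → ℝ := fun U =>
    ∑ a : Fin 3, ∑ i : Fin 4, ∑ b : Fin 3, ∑ j : Fin 4,
      ‖(diracMatrix U mq)⁻¹ (quarkEquiv (f, (Torus.proj (2 * reg.L k + 1) 0, a, i)))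
        (quarkEquiv (f, (Torus.proj (2 * reg.L k + 1) (Pi.single 0 (reg.L k : ℤ)), b, j)))‖ ^ (2 : ℕ) with hX
  have hdet : ∀ U : GaugeConfig 4 (2 * reg.L k + 1) (Matrix.specialUnitaryGroup (Fin 3) ℂ),
      (diracMatrix U mq).det = ((‖(diracMatrix U mq).det‖ : ℝ) : ℂ) := fun U =>
    det_diracMatrix_eq_norm_of_pos U mq fun _ => hk
  have hnum : (∫ U, (diracMatrix U mq).det * ((X U : ℝ) : ℂ) ∂μ) =
      ((∫ U, ‖(diracMatrix U mq).det‖ * X U ∂μ : ℝ) : ℂ) := by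
    rw [← integral_complex_ofReal]
    refine integral_congr_ae (Eventually.of_forall fun U => ?_)
    beta_reduce
    rw [Complex.ofReal_mul, ← hdet U]
  have hden : (∫ U, (diracMatrix U mq).det ∂μ) = ((∫ U, ‖(diracMatrix U mq).det‖ ∂μ : ℝ) : ℂ) := by
    rw [← integral_complex_ofReal]
    exact integral_congr_ae (Eventually.of_forall fun U => hdet U)
  change 1 * ((∫ U, ‖(diracMatrix U mq).det‖ * X U ∂μ) / (∫ U, ‖(diracMatrix U mq).det‖ ∂μ)) ≤
    ‖(∫ U, (diracMatrix U mq).det * ((X U : ℝ) : ℂ) ∂μ) / (∫ U, (diracMatrix U mq).det ∂μ)‖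
  rw [one_mul, hnum, hden, ← Complex.ofReal_div, Complex.norm_real, Real.norm_eq_abs]
  exact le_abs_self _

/-- **NoCollapse at positive degenerate tuples ⇒ chirality at zero (any `N_f ≥ 2`, superlogarithmic volume).**
The landed chain `signedPin_of_lowerPins_signCoh → chiralityTransfer_ae` with the sign kernel discharged by
`signCoh_one_of_eventually_pos`. [folklore] -/
theorem isChiralAtZero_of_noCollapse_pos (hNf : 2 ≤ Nf) (reg : QCDRegularisation Nf) (f g : Fin Nf) (hfg : f ≠ g)
    (hvol : Tendsto (fun k => reg.a k * reg.L k / (1 + |Real.log (reg.a k)|)) atTop atTop)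
    (hpos : ∀ m : ℝ, 0 < m → ∀ᶠ k in atTop, 0 < reg.mcrit k + reg.a k * m / reg.Zm k)
    (hNC : (∀ ε : ℝ, 0 < ε → ∃ m s c₀ C₁ p : ℝ, 0 < m ∧ 0 < s ∧ s ≤ 2 ∧ 0 < c₀ ∧ C₁ < s * ε / 2 ∧ ∀ᶠ k in atTop, ∀ S : ℕ, reg.L k ≤ S → ∀ n : ℕ, n ≤ S → c₀ * Real.exp (-(C₁ * (reg.a k * n) + p * Real.log (n + 1))) ≤ (∫ U : GaugeConfig 4 (2 * S + 1) (Matrix.specialUnitaryGroup (Fin 3) ℂ), ‖(diracMatrix U fun _ : Fin Nf => reg.mcrit k + reg.a k * m / reg.Zm k).det‖ * (∑ a : Fin 3, ∑ i : Fin 4, ∑ b : Fin 3, ∑ j : Fin 4, ‖(diracMatrix U fun _ : Fin Nf => reg.mcrit k + reg.a k * m / reg.Zm k)⁻¹ (quarkEquiv (f, (Torus.proj (2 * S + 1) 0, a, i))) (quarkEquiv (f, (Torus.proj (2 * S + 1) (Pi.single 0 (n : ℤ)), b, j)))‖) ^ s ∂(wilsonMeasure (fundamentalRep (Fin 3)) (reg.β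 k))) / (∫ U : GaugeConfig 4 (2 * S + 1) (Matrix.specialUnitaryGroup (Fin 3) ℂ), ‖(diracMatrix U fun _ : Fin Nf => reg.mcrit k + reg.a k * m / reg.Zm k).det‖ ∂(wilsonMeasure (fundamentalRep (Fin 3)) (reg.β k))))) :
    reg.IsChiralAtZero := by
  have ha1 : ∀ᶠ k in atTop, reg.a k ≤ 1 := reg.tendsto_a.eventually (eventually_le_nhds one_pos)
  exact chiralityTransfer_ae Nf f g hfg reg
    (signedPin_of_lowerPins_signCoh Nf hNf reg f ha1 hvol hNC (signCoh_one_of_eventually_pos reg f hpos))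

/-- **A window on `m_crit` is a window on every realised bare tuple.** Under leading-log mass scaling with
`γ₀/(2β₀) ≥ 0`, `c a_k ≤ m_crit(k) ≤ 1/2` eventually gives `c a_k ≤ m_f(k) ≤ 1` eventually for every positive tuple
(`a_k m_f/Z_m(k) → 0`). [folklore] -/
theorem eventually_bare_window_of_mcrit_window (reg : QCDRegularisation Nf) (hms : reg.HasMassScaling)
    (hγ : 0 ≤ massExponent Nf) {c : ℝ} (hk : ∀ᶠ k in atTop, c * reg.a k ≤ reg.mcrit k ∧ reg.mcrit k ≤ 1 / 2)
    (m : Fin Nf → ℝ) (hm : ∀ f, 0 < m f) :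
    ∀ᶠ k in atTop, ∀ f, c * reg.a k ≤ bare reg m k f ∧ bare reg m k f ≤ 1 := by
  set M : ℝ := (∑ f, m f) + 1 with hMdef
  have hmM : ∀ f, m f ≤ M := fun f =>
    (Finset.single_le_sum (fun g _ => (hm g).le) (Finset.mem_univ f)).trans (le_add_of_nonneg_right zero_le_one)
  have hsmall := eventually_a_mul_div_Zm_le reg hms hγ M (1 / 2) (by norm_num)
  filter_upwards [hk, hsmall] with k hk hks f
  have ha := reg.a_pos k
  have hZ := reg.Zm_pos k
  have hq : 0 ≤ reg.a k * m f / reg.Zm k := div_nonneg (mul_nonneg ha.le (hm f).le) hZ.le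
  have hq' : reg.a k * m f / reg.Zm k ≤ 1 / 2 := by
    refine le_trans ?_ hks
    exact div_le_div_of_nonneg_right (mul_le_mul_of_nonneg_left (hmM f) ha.le) hZ.le
  simp only [bare]
  constructor <;> linarith [hk.1, hk.2]

/-- **The positive-mass branch map.** For `N_f ∈ {2,3}`: if some regularisation with leading-log mass scaling and
two-loop asymptotic scaling keeps its critical mass in `[c a_k, 1/2]` eventually (`c > 0`), has superlogarithmic
physical volume `a_k L_k/(1+|log a_k|) → ∞`, satisfies clause (iii) LOWER of the crux for EVERY positive mass tuple,
and, for one pair of distinct flavours, the NoCollapse lower pins at the degenerate tuples (for every rate `ε` some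
`m > 0` with a clause-(iii)-shaped lower bound at rate `C₁ < sε/2`), then `ChiralOneScaleTrajectory` holds — clause (i),
the one-scale shell, clause (iv), the sign kernel and the chirality transfer being free on this branch.  PHYSICS
CAVEAT: the hypothesis is expected to be false (`m_c(β) < 0`); the theorem maps where the content of the crux sits on
the positive branch — clause (iii) with no rate floor — it is not a proof strategy. [folklore] -/
theorem chiralOneScaleTrajectory_of_posLowerNoCollapse : (∀ Nf : ℕ, Nf = 2 ∨ Nf = 3 → ∃ reg : QCDRegularisation Nf, reg.HasMassScaling ∧ (reg.scheme 0 0 0).HasAsymptoticScaling ∧ (∃ c : ℝ, 0 < c ∧ ∀ᶠ k in atTop, c * reg.a k ≤ reg.mcrit k ∧ reg.mcrit k ≤ 1 / 2) ∧ Tendsto (fun k => reg.a k * reg.L k / (1 + |Real.log (reg.a k)|)) atTop atTop ∧ (∀ m : Fin Nf → ℝ, (∀ f, 0 < m f) → Lower reg m) ∧ ∃ f g : Fin Nf, f ≠ g ∧ (∀ ε : ℝ, 0 < ε → ∃ m s c₀ C₁ p : ℝ, 0 < m ∧ 0 < s ∧ s ≤ 2 ∧ 0 < c₀ ∧ C₁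 < s * ε / 2 ∧ ∀ᶠ k in atTop, ∀ S : ℕ, reg.L k ≤ S → ∀ n : ℕ, n ≤ S → c₀ * Real.exp (-(C₁ * (reg.a k * n) + p * Real.log (n + 1))) ≤ (∫ U : GaugeConfig 4 (2 * S + 1) (Matrix.specialUnitaryGroup (Fin 3) ℂ), ‖(diracMatrix U fun _ : Fin Nf => reg.mcrit k + reg.a k * m / reg.Zm k).det‖ * (∑ a : Fin 3, ∑ i : Fin 4, ∑ b : Fin 3, ∑ j : Fin 4, ‖(diracMatrix U fun _ : Fin Nf => reg.mcrit k + reg.a k * m / reg.Zm k)⁻¹ (quarkEquiv (f, (Torus.proj (2 * S + 1) 0, a, i))) (quarkEquiv (f, (Torus.proj (2 * S + 1) (Pi.single 0 (n : ℤ)), b, j)))‖) ^ s ∂(wilsonMeasure (fundamentalRep (Fin 3)) (reg.β k))) / (∫ U : GaugeConfig 4 (2 * S + 1) (Matrix.specialUnitaryGroup (Fin 3) ℂ), ‖(diracMatrix U fun _ : Fin Nf => reg.mcrit k + reg.a k * m / reg.Zm k).det‖ ∂(wilsonMeasure (fundamentalRep (Fin 3)) (reg.β k))))) → ChiralOneScaleTrajectory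 := by
  intro h
  refine chiralOneScaleTrajectory_of_clauses_superlog fun Nf hNf => ?_
  obtain ⟨reg, hms, has, ⟨c, hc, hk⟩, hvol, hlow, f, g, hfg, hNC⟩ := h Nf hNf
  have hNf2 : 2 ≤ Nf := by rcases hNf with rfl | rfl <;> norm_num
  have hγ : 0 < massExponent Nf := massExponent_pos (by rcases hNf with rfl | rfl <;> norm_num)
  -- positivity of the degenerate bare masses, eventually, for every `m > 0`
  have hpos : ∀ m : ℝ, 0 < m → ∀ᶠ k in atTop, 0 < reg.mcrit k + reg.a k * m / reg.Zm k := fun m hm =>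
    hk.mono fun k hk => by
      have h1 : 0 < c * reg.a k := mul_pos hc (reg.a_pos k)
      have h2 : 0 ≤ reg.a k * m / reg.Zm k := div_nonneg (mul_nonneg (reg.a_pos k).le hm.le) (reg.Zm_pos k).le
      linarith [hk.1]
  refine ⟨reg, ⟨isChiralAtZero_of_noCollapse_pos hNf2 reg f g hfg hvol hpos hNC, hms, has, fun m hm => ?_⟩, hvol⟩
  have hwin := eventually_bare_window_of_mcrit_window reg hms hγ.le hk m hm
  have hposk : ∀ᶠ k in atTop, ∀ f, 0 < bare reg m k f :=
    hwin.mono fun k hk f => lt_of_lt_of_le (mul_pos hc (reg.a_pos k)) (hk f).1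
  exact ⟨clauseI_of_eventually_pos reg m hposk, upper_of_eventually_pos_light reg m ⟨c, hc, hwin⟩, hlow m hm,
    sign_of_eventually_pos reg m hposk⟩

end Summit.QuantumFields.QCD.Cruxes.ChiralOneScaleTrajectory.GoldstoneWitness

end
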